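import Mathlib
import HarnessLib
import Summits.Langlands.Langlands.Theorems.EisensteinGelfandKirillovProModularOfGKBoundStubHostTraceAlgebraLocal
import Summits.Langlands.Langlands.Theorems.EisensteinGelfandKirillovProModularOfGKBoundStubHostAlgEquivExtend

/-!
# Route `EisensteinGelfandKirillov`, crux `ProModularOfGKBound` (stmt-Langlands-18273), line `two-leaf-fern`:
# `stub_host` — the trace algebra is a host

Conclusion of the construction of `…StubHostTraceAlgebra.lean` (the compact trace algebra `R_tr` of the lifts
of `ρ` with its pseudocharacter `T = (tr ρ')_{ρ'}`, clause (G)) and `…StubHostTraceAlgebraLocal.lean`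
(`R_tr` is local with `p ∈ 𝔪`).  Here the remaining clauses of the line's interface `Host`:

* the POINTS `point ρ' : R_tr → ℚ̄_p` (coordinate projections; continuous, `point ρ' ∘ T = tr ρ'`) give (U2)
  `exists_point` tautologically and the base point (the coordinate of `ρ` itself);
* (U0) `traceR_mul_of_mem_inertia`: `T(gσ) = T(g)` for `σ` in an inertia group at `v ∉ badSet p ρ` (every lift is
  unramified there);
* (D) `exists_algEquiv_det`: for a continuous point `x`, the CONSTANTS `c_g = ½ (T(g)² − T(g²)) ∈ R_tr` have all
  coordinates `det ρ₀(g)` (Cayley–Hamilton in rank `2` and `det ρ'₀ = det ρ₀`), so `x` restricted to the closed subring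
  `Λ = closure ℤ[det ρ₀(Γ_F)] ⊆ E_ρ` (embedded diagonally into `R_tr`) is a continuous ring map `Λ → ℚ̄_p`, hence
  (`stub_algEquivExtend`, landed) the restriction of some `σ ∈ Gal(ℚ̄_p/ℚ_p)`; so `x(T g)² − x(T g²) = 2σ(det ρ g)`.

Assembling: `theorem stub_host` (registered stub H of the line). [cite: Chenevier2014, §3, Prop. 3.3 and Ex. 3.7]
[cite: BellaicheChenevier2009, §1.4] [cite: Taylor1991, §1]
-/

set_option linter.dupNamespace false
set_option autoImplicit false

noncomputable section

open scoped NumberField Matrix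
open Filter Field IsDedekindDomain Topology
open Literature.NumberTheory.GaloisRepresentations Literature.NumberTheory.Automorphic
open Literature.NumberTheory.Automorphic.BigHeckeGLn

namespace Summit.Langlands.Langlands.Cruxes.ProModularOfGKBound.TwoLeafFern

namespace TraceHost

variable {F : Type} [Field F] [NumberField F] {p : ℕ} [Fact p.Prime]
variable {ρ : FramedGaloisRep F (PadicAlgCl p) 2} {ρ₀ : absoluteGaloisGroup F →* GL (Fin 2) (Oint p)}

/-! ### Points -/

/-- The continuous point of `R_tr` indexed by the lift `ρ'`: the coordinate projection. [folklore] -/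
def point (s : LiftDatum p ρ ρ₀) : ring ρ ρ₀ →+* PadicAlgCl p :=
  (Pi.evalRingHom (fun _ : LiftDatum p ρ ρ₀ => PadicAlgCl p) s).comp (ring ρ ρ₀).subtype

/-- The points are continuous. [folklore] -/
theorem continuous_point (s : LiftDatum p ρ ρ₀) : Continuous (point s) :=
  (continuous_apply s).comp continuous_subtype_val

/-- `point ρ' ∘ T = tr ρ'`. [folklore] -/
theorem point_traceR (s : LiftDatum p ρ ρ₀) (g : absoluteGaloisGroup F) :
    point s (traceR g) = FramedRep.trace s.rep g := rfl

/-! ### (U0) unramifiedness of `T` outside `badSet p ρ` -/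

/-- Inertia at places outside `badSet p ρ` lies in the kernel of `T` (every lift is unramified there).
[folklore] -/
theorem traceR_mul_of_mem_inertia {v : HeightOneSpectrum (𝓞 F)} (hv : v ∉ badSet p ρ)
    {𝔓 : Ideal (absIntegers (𝓞 F) F)} (h𝔓 : 𝔓 ∈ v.primesAbove) {σ : absoluteGaloisGroup F}
    (hσ : σ ∈ 𝔓.inertia (absoluteGaloisGroup F)) (g : absoluteGaloisGroup F) :
    traceR (ρ := ρ) (ρ₀ := ρ₀) (g * σ) = traceR g := by
  apply Subtype.ext
  funext s
  change FramedRep.trace s.rep (g * σ) = FramedRep.trace s.rep g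
  rw [FramedRep.trace, FramedRep.trace, map_mul, s.unram v hv 𝔓 h𝔓 σ hσ, mul_one]

/-! ### (D) the constants and the Galois-equivariant determinant -/

omit [NumberField F] in
/-- Cayley–Hamilton in rank two: `tr(A)² − tr(A²) = 2 det A`. [folklore] -/
theorem trace_sq_sub_trace_sq {A : Type*} [CommRing A] (M : Matrix (Fin 2) (Fin 2) A) :
    M.trace ^ 2 - (M * M).trace = 2 * M.det := by
  simp only [Matrix.trace_fin_two, Matrix.det_fin_two, Matrix.mul_apply, Fin.sum_univ_two]
  ring

/-- The coordinates of `T(g)² − T(g²)` are all equal to `2 det ρ₀(g)`. [folklore] -/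
theorem coe_traceR_sq_sub (g : absoluteGaloisGroup F) (s : LiftDatum p ρ ρ₀) :
    ((traceR (ρ := ρ) (ρ₀ := ρ₀) g ^ 2 - traceR (g * g) : ring ρ ρ₀) : Amb ρ ρ₀) s =
      2 * ((ρ₀ g).val.det : PadicAlgCl p) := by
  rw [← s.det_rep g]
  change FramedRep.trace s.rep g ^ 2 - FramedRep.trace s.rep (g * g) = _
  rw [FramedRep.trace, FramedRep.trace, map_mul, Units.val_mul]
  exact trace_sq_sub_trace_sq _

/-- The closed subring `Λ = closure ℤ[det ρ₀(Γ_F)] ⊆ ℚ̄_p` of the determinant values. [folklore] -/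
def detRing (ρ₀ : absoluteGaloisGroup F →* GL (Fin 2) (Oint p)) : Subring (PadicAlgCl p) :=
  (Subring.closure (Set.range fun g => ((ρ₀ g).val.det : PadicAlgCl p))).topologicalClosure

/-- `Λ` lies in the model field of every lift. [folklore] -/
theorem detRing_le_fld (s : LiftDatum p ρ ρ₀) : detRing ρ₀ ≤ s.fld.toSubring := by
  refine Subring.topologicalClosure_minimal _ (Subring.closure_le.2 ?_) (isClosed_intermediateField_padicAlgCl s.fld)
  rintro _ ⟨g, rfl⟩
  change ((ρ₀ g).val.det : PadicAlgCl p) ∈ s.fld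
  rw [← s.det_rep g]
  exact s.det_mem_fld g

/-- The diagonal embedding of `Λ` lands in `R_tr`: the generators `det ρ₀(g)` go to the constants
`½ (T(g)² − T(g²)) ∈ R_tr`, and `R_tr` is closed. [folklore] -/
theorem detRing_le_comap [Nonempty (LiftDatum p ρ ρ₀)] (hp : p ≠ 2) :
    detRing ρ₀ ≤ (ring ρ ρ₀).comap (Pi.constRingHom (LiftDatum p ρ ρ₀) (PadicAlgCl p)) := by
  haveI := isLocalRing_ring (ρ := ρ) (ρ₀ := ρ₀)
  have h2 : IsUnit (2 : ring ρ ρ₀) := by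
    have h := isUnit_natCast_of_coprime (R := ring ρ ρ₀) (n := 2) natCast_mem_maximalIdeal
      ((Nat.coprime_primes Nat.prime_two (Fact.out : p.Prime)).2 (Ne.symm hp))
    simpa using h
  obtain ⟨u, hu⟩ := h2
  have hclosed : IsClosed (((ring ρ ρ₀).comap (Pi.constRingHom (LiftDatum p ρ ρ₀) (PadicAlgCl p)) :
      Subring (PadicAlgCl p)) : Set (PadicAlgCl p)) := by
    rw [Subring.coe_comap]
    exact (Subring.isClosed_topologicalClosure _).preimage (continuous_pi fun _ => continuous_id)
  refine Subring.topologicalClosure_minimal _ (Subring.closure_le.2 ?_) hclosed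
  rintro _ ⟨g, rfl⟩
  rw [SetLike.mem_coe, Subring.mem_comap]
  -- the constant `det ρ₀ g` is `u⁻¹ (T g² − T(g g))`
  have key : (Pi.constRingHom (LiftDatum p ρ ρ₀) (PadicAlgCl p)) ((ρ₀ g).val.det : PadicAlgCl p) =
      (((↑u⁻¹ : ring ρ ρ₀) * (traceR g ^ 2 - traceR (g * g)) : ring ρ ρ₀) : Amb ρ ρ₀) := by
    funext s
    rw [Pi.constRingHom_apply, Function.const_apply, Subring.coe_mul, Pi.mul_apply, coe_traceR_sq_sub, ← mul_assoc]
    have h1 : ((↑u⁻¹ : ring ρ ρ₀) : Amb ρ ρ₀) s * 2 = 1 := by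
      have e := congrArg (fun x : ring ρ ρ₀ => (x : Amb ρ ρ₀) s) u.inv_mul
      rw [hu] at e
      have e2 : ((2 : ring ρ ρ₀) : Amb ρ ρ₀) s = 2 := by
        rw [show (2 : ring ρ ρ₀) = ((2 : ℕ) : ring ρ ρ₀) by norm_cast, SubringClass.coe_natCast,
          Pi.natCast_apply, Nat.cast_ofNat]
      simpa [e2] using e
    rw [h1, one_mul]
  rw [key]
  exact SetLike.coe_mem _

/-- **(D) for the trace algebra**: every continuous point `x` of `R_tr` has determinant `σ ∘ det ρ₀` for some
`σ ∈ Gal(ℚ̄_p/ℚ_p)`: `x(T g)² − x(T g²) = 2 σ(det ρ₀ g)` (restrict `x` to the diagonal copy of `Λ` and extend with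
`stub_algEquivExtend`). [folklore] -/
theorem exists_algEquiv_det (hp : p ≠ 2) (s₀ : LiftDatum p ρ ρ₀) (x : ring ρ ρ₀ →+* PadicAlgCl p)
    (hx : Continuous x) :
    ∃ σ : PadicAlgCl p ≃ₐ[ℚ_[p]] PadicAlgCl p, ∀ g,
      x (traceR g) ^ 2 - x (traceR (g * g)) = 2 * σ ((ρ₀ g).val.det : PadicAlgCl p) := by
  haveI : Nonempty (LiftDatum p ρ ρ₀) := ⟨s₀⟩
  have hle := detRing_le_comap (ρ := ρ) (ρ₀ := ρ₀) hp
  -- the diagonal embedding `j : Λ → R_tr`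
  let j : detRing ρ₀ →+* ring ρ ρ₀ :=
    ((Pi.constRingHom (LiftDatum p ρ ρ₀) (PadicAlgCl p)).comp (detRing ρ₀).subtype).codRestrict (ring ρ ρ₀)
      fun l => hle l.2
  have hj : Continuous j :=
    Continuous.subtype_mk ((continuous_pi fun _ => continuous_id).comp continuous_subtype_val) _
  have hjval : ∀ l : detRing ρ₀, ((j l : ring ρ ρ₀) : Amb ρ ρ₀) = Function.const _ (l : PadicAlgCl p) := fun l => rfl
  obtain ⟨σ, hσ⟩ := stub_algEquivExtend p s₀.fld inferInstance (detRing ρ₀) (Subring.isClosed_topologicalClosure _)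
    (detRing_le_fld s₀) (x.comp j) (hx.comp hj)
  refine ⟨σ, fun g => ?_⟩
  have hmem : ((ρ₀ g).val.det : PadicAlgCl p) ∈ detRing ρ₀ :=
    (Subring.closure _).le_topologicalClosure (Subring.subset_closure ⟨g, rfl⟩)
  have h1 : (2 : ring ρ ρ₀) * j ⟨_, hmem⟩ = traceR g ^ 2 - traceR (g * g) := by
    apply Subtype.ext
    funext s
    rw [Subring.coe_mul, Pi.mul_apply, hjval, Function.const_apply, coe_traceR_sq_sub]
    rfl
  have h2 := hσ ⟨_, hmem⟩
  rw [RingHom.comp_apply] at h2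
  rw [← map_pow, ← map_sub, ← h1, map_mul, map_ofNat, h2]

end TraceHost

/-! ### The stub -/

open TraceHost in
/-- **Stub H — `stub_host`: the interface `Host p O ρ ρ₀` is inhabited** — by the TRACE ALGEBRA `R_tr` of the
lifts of `ρ` (closure of `ℤ[(tr ρ')_{ρ'}]` in `∏_{ρ'} (E_{ρ'} ∩ O)`): compact Hausdorff (`…StubHostTraceAlgebra`),
local with `p ∈ 𝔪` (`…StubHostTraceAlgebraLocal`), `T = (tr ρ')_{ρ'}` a continuous `2`-dimensional
pseudocharacter generating it (G), unramified outside `badSet p ρ` (U0), points = coordinates ((U2) and the base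
point, the coordinate of `ρ` itself), Galois-equivariantly fixed determinant (D) (`exists_algEquiv_det` +
`stub_algEquivExtend`).  Hypotheses used: the integral model in the same frame (`hup.1`) to make `ρ` a lift of
itself; `5 ≤ p` only through `p ≠ 2`; the a.e.-unramified hypothesis is not needed for the construction.
[cite: Chenevier2014, §3, Prop. 3.3 and Ex. 3.7] [cite: BellaicheChenevier2009, §1.4] [cite: Taylor1991, §1] -/
theorem stub_host :
    ∀ (F : Type) [Field F] [NumberField F] (p : ℕ) [Fact p.Prime], 5 ≤ p →
    ∀ (O : ValuationSubring (PadicAlgCl p)),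
      O = (Valued.v : Valuation (PadicAlgCl p) NNReal).valuationSubring →
    ∀ (ρ : FramedGaloisRep F (PadicAlgCl p) 2) (ρ₀ : absoluteGaloisGroup F →* GL (Fin 2) O),
      ρ.HasUpperTriangularIntegralModel ρ₀ →
      (∀ᶠ v in cofinite, ρ.IsUnramifiedAt v) →
      Nonempty (Host p O ρ ρ₀) := by
  intro F _ _ p _ hp O hO ρ ρ₀ hup _hur
  subst hO
  have hp2 : p ≠ 2 := by omega
  -- `ρ` is a lift of itself
  let s₀ : LiftDatum p ρ ρ₀ :=
    { rep := ρ
      model := ρ₀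
      map_model := hup.1
      trace_congr := fun g => by rw [sub_self]; exact Ideal.zero_mem _
      det_eq := fun g => rfl
      unram := fun v hv => ((not_mem_badSet_iff p ρ v).1 hv).1 }
  haveI : Nonempty (LiftDatum p ρ ρ₀) := ⟨s₀⟩
  haveI : IsLocalRing (ring ρ ρ₀) := isLocalRing_ring
  refine ⟨{ R := ring ρ ρ₀
            mem_maximalIdeal := natCast_mem_maximalIdeal
            T := pseudochar
            traces_dense := traces_dense
            unramified := fun v hv 𝔓 h𝔓 σ hσ g => traceR_mul_of_mem_inertia hv h𝔓 hσ g
            det_point := fun x hx => ?_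
            base := point s₀
            continuous_base := continuous_point s₀
            base_spec := fun g => rfl
            exists_point := fun ρ' ρ'₀ h1 h2 h3 h4 =>
              ⟨point ⟨ρ', ρ'₀, h1, h2, h3, h4⟩, continuous_point _, fun g => rfl⟩ }⟩
  obtain ⟨σ, hσ⟩ := exists_algEquiv_det hp2 s₀ x hx
  refine ⟨σ, fun g => ?_⟩
  rw [pseudochar_apply, pseudochar_apply, hσ g, ← s₀.det_rep g]

end Summit.Langlands.Langlands.Cruxes.ProModularOfGKBound.TwoLeafFern

end
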